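import Summits.NavierStokesRegularity.FunctionalMining.TopEigGapCoercivePow
import HarnessLib

/-!
# FunctionalMining — quantitative near-biaxiality of heat-cheap fields (corollary of L-λ(η))

Search for candidate a priori estimates; no regularity claim. Cell `pub-nsfunc`, prove seat (gen 26).
Contrapositive, BY VALUE, of the kernel Proposition L-λ(η) (`topEigMoment_two_le_heatDissipation_of_gap`,
`TopEigGapCoerciveTwo.lean`; `topEigMoment_rpow_le_heatDissipation_of_gap`, `TopEigGapCoercivePow.lean`):
a smooth divergence-free field on `T³` whose heat price is SMALL relative to its moment must have a
NEAR-BIAXIAL point, with an explicit threshold at `q = 2`: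

* **`exists_midEig_gt_of_heatDissipation_lt`** — if `T₂(v) < (2π²η/9)·Φ₂(v)` for some `0 < η ≤ 1`, then
  there is a point with `λ₂(x) > (1 − η)λ₁(x)`; equivalently (`exists_midEig_gt_of_ratio_lt`): if
  `Φ₂(v) > 0` and `9 T₂(v)/(2π² Φ₂(v)) < η ≤ 1` then `λ₂ > (1−η)λ₁` somewhere — the census-measurable
  prediction "`sup_x λ₂/λ₁ ≥ 1 − (9/(2π²))·T₂/Φ₂`" for fields with positive `λ₁` at the witness point;
* `exists_midEig_gt_of_heatDissipation_rpow_lt` — the same at `2 < q ≤ 6` with the existential constant of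
  `TopEigGapCoercivePow` (through the hypothesis `∫‖v‖²λ₁^{q−2} ≤ KΦ_q`).

[ours]
-/

noncomputable section

open Filter Topology Matrix Finset MeasureTheory

namespace Summit.NavierStokesRegularity.FunctionalMining

open Literature.Analysis Literature.Analysis.FunctionSpaces Literature.Analysis.FunctionSpaces.Torus

namespace TopEig

variable {v : UnitAddTorus (Fin 3) → EuclideanSpace ℝ (Fin 3)}

/-- **Heat-cheap fields have near-biaxial points (`q = 2`, explicit).** If `v` is smooth and divergence
free on `T³`, `0 < η ≤ 1`, and `T₂(v) < (2π²η/9)·Φ₂(v)`, then `λ₂(x) > (1−η)λ₁(x)` at some point `x`.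
[ours; contrapositive of `topEigMoment_two_le_heatDissipation_of_gap`] -/
theorem exists_midEig_gt_of_heatDissipation_lt (hv : Torus.IsSmooth v) (hdiv : Torus.IsDivFree v)
    {η : ℝ} (hη0 : 0 < η) (hη1 : η ≤ 1)
    (hlt : heatDissipation (torusTopEigMoment 2) v < 2 * Real.pi ^ 2 * η / 9 * torusTopEigMoment 2 v) :
    ∃ x : UnitAddTorus (Fin 3), (1 - η) * torusStrainTopEig v x < torusStrainMidEig v x := by
  by_contra h
  simp only [not_exists, not_lt] at h
  exact absurd (topEigMoment_two_le_heatDissipation_of_gap hv hdiv hη0 hη1 h) (not_le.2 hlt)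

/-- **Ratio form.** If `Φ₂(v) > 0` and `9·T₂(v)/(2π²·Φ₂(v)) < η ≤ 1`, then `λ₂ > (1−η)λ₁` somewhere: the
top-gap parameter of a field is at most `9T₂/(2π²Φ₂)`, i.e. `sup λ₂/λ₁ ≥ 1 − (9/(2π²))·T₂/Φ₂` over the points
with `λ₁ > 0`. [ours] -/
theorem exists_midEig_gt_of_ratio_lt (hv : Torus.IsSmooth v) (hdiv : Torus.IsDivFree v)
    (hF : 0 < torusTopEigMoment 2 v) {η : ℝ} (hη1 : η ≤ 1)
    (hR : 9 * heatDissipation (torusTopEigMoment 2) v / (2 * Real.pi ^ 2 * torusTopEigMoment 2 v) < η) :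
    ∃ x : UnitAddTorus (Fin 3), (1 - η) * torusStrainTopEig v x < torusStrainMidEig v x := by
  have hT0 : 0 ≤ heatDissipation (torusTopEigMoment 2) v :=
    heatDissipation_nonneg_of_admissible (q := 2) (by norm_num) convexOn_lam lipschitzWith_lam
      (fun _ hv hdiv x => lam_strainFlat_nonneg hv hdiv x)
      (fun _ hv hdiv => torusTopEigMoment_eq hv hdiv 2) hv hdiv
  have hπ : 0 < 2 * Real.pi ^ 2 * torusTopEigMoment 2 v := by positivity
  have hη0 : 0 < η := lt_of_le_of_lt (by positivity) hR
  refine exists_midEig_gt_of_heatDissipation_lt hv hdiv hη0 hη1 ?_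
  rw [div_lt_iff₀ hπ] at hR
  have e : 2 * Real.pi ^ 2 * η / 9 * torusTopEigMoment 2 v = η * (2 * Real.pi ^ 2 * torusTopEigMoment 2 v) / 9 := by
    ring
  rw [e, lt_div_iff₀ (by norm_num : (0 : ℝ) < 9)]
  linarith

/-- **Heat-cheap fields have near-biaxial points, `2 < q ≤ 6`.** With the Sobolev–Hölder bound
`∫‖v‖²λ₁^{q−2} ≤ K·Φ_q(v)` (`K ≥ 0`; `exists_integral_norm_sq_mul_topEig_rpow_le` for zero-mean `v`):
if `T_q(v) < (ηq/(3(q−1)(K+1)))·Φ_q(v)` for some `0 < η ≤ 1`, then `λ₂ > (1−η)λ₁` somewhere.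
[ours; contrapositive of `topEigMoment_rpow_le_heatDissipation_of_gap`] -/
theorem exists_midEig_gt_of_heatDissipation_rpow_lt (hv : Torus.IsSmooth v) (hdiv : Torus.IsDivFree v)
    {q : ℝ} (hq : 2 < q) {η : ℝ} (hη0 : 0 < η) (hη1 : η ≤ 1) {K : ℝ} (hK0 : 0 ≤ K)
    (hK : ∫ x, ‖v x‖ ^ 2 * torusStrainTopEig v x ^ (q - 2) ≤ K * torusTopEigMoment q v)
    (hlt : heatDissipation (torusTopEigMoment q) v <
      η * q / (3 * (q - 1) * (K + 1)) * torusTopEigMoment q v) :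
    ∃ x : UnitAddTorus (Fin 3), (1 - η) * torusStrainTopEig v x < torusStrainMidEig v x := by
  by_contra h
  simp only [not_exists, not_lt] at h
  exact absurd (topEigMoment_rpow_le_heatDissipation_of_gap hv hdiv hq hη0 hη1 h hK0 hK) (not_le.2 hlt)

end TopEig

end Summit.NavierStokesRegularity.FunctionalMining

end
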